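import Mathlib
import Literature.Computability.AlgebraicComplexity.AsymptoticSpectrum
import Literature.Computability.AlgebraicComplexity.BorderRankCW
import Literature.Computability.AlgebraicComplexity.MatrixMultiplicationExponent
import Literature.Computability.AlgebraicComplexity.FlatteningBound
import Literature.Barriers.ValiantsHypothesis.BIJL18MatrixCompletionProofs
import Summits.MatrixMultiplication.MatrixMultiplication.Theses.OutsiderSandwich

/-!
# OutsiderSandwich — no Kronecker power of `cw₂` is EXACTLY MM-perfect
(decomp-mm lens 4 «minimal-counterexample / extremal reduction», gen 6)

ω-free law, proved outright: for every `N ≥ 1`, if `⟨m,m,m⟩` is a restriction of `cw₂^{⊠N}` then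
`m² < 3^N` — the flattening bound `m² ≤ 3^N` is never attained (route aside
`CwTwoNoExactPerfection`, item stmt-MatrixMultiplication-29786), and in particular
`⟨3,3,3⟩ ⋬ cw₂^{⊠2}` (aside `MMThreeNotInCwTwoPowTwo`, item 29787) without any border-rank input.
The argument is uniform in `q`: no Kronecker power of any little Coppersmith–Winograd tensor
`cw_q` (`q ≥ 1`) restricts onto `⟨m,m,m⟩` with `m² = (q+1)^N` (`sq_ne_pow_of_restricts`).

Proof.  Let `A, B, C` be restriction matrices (`m² × 3^N`).  `⟨m,m,m⟩` is concise (tree: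
`linearIndependent_matMulTensor` and its two rotations), so the covector maps `ξ ↦ ξᵀA, ξᵀB, ξᵀC`
are injective — a covector killed by `A` kills the corresponding combination of slices, because
the slice spaces are related by `S(ξ) = B · T(ξᵀA) · Cᵀ` (`sliceMat_restricts`).  Injectivity
alone gives `m² ≤ 3^N`.  If `m² = 3^N` the three maps are bijective; pick `ξ₀` with
`ξ₀ᵀA = e_{0^N}`.  Then `T(e_{0^N}) = cw₂^{⊠N}(0^N,·,·)` is the diagonal 0/1 matrix supported on
`{1,2}^N`, of rank `2^N`, and `rank S(ξ₀) = 2^N` since `B`, `Cᵀ` are invertible; but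
`S(ξ)((κ,μ),(μ',ν)) = [μ = μ']·ξ(κ,ν)` is block diagonal with `m` equal blocks, of rank
`m · rank ξ`.  Hence `m ∣ 2^N`, contradicting `3 ∣ m` (for `cw_q`: a prime factor of `m` would
divide both `q + 1` and `q`).
-/

set_option linter.dupNamespace false

namespace Summit.MatrixMultiplication.MatrixMultiplication.Theorems.OutsiderSandwichNoExactPerfection

open Literature.Computability.AlgebraicComplexity
open scoped Matrix

section General

variable {K : Type*} [Field K]
variable {ι κ μ ι' κ' μ' : Type*} [Fintype ι] [Fintype κ] [Fintype μ]
  [Fintype ι'] [Fintype κ'] [Fintype μ']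

/-- The slice of a tensor `t` along its first mode at the covector `η`, as a matrix:
`T(η)(b,c) = ∑ₐ η(a) t(a,b,c)`. [folklore] -/
def sliceMat (t : ι → κ → μ → K) (η : ι → K) : Matrix κ μ K :=
  Matrix.of fun b c => ∑ a, η a * t a b c

omit [Fintype κ] [Fintype μ] in
/-- the slice pencil member at `η` is the `η`-combination of the slices. [folklore] -/
theorem sliceMat_eq_sum (t : ι → κ → μ → K) (η : ι → K) :
    sliceMat t η = ∑ a, η a • Matrix.of (t a) := by
  ext b c
  simp [sliceMat, Matrix.of_apply, Matrix.sum_apply]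

omit [Fintype κ] [Fintype μ] in
/-- the slice pencil member at `η = 0` is the zero matrix. [folklore] -/
theorem sliceMat_zero (t : ι → κ → μ → K) : sliceMat t 0 = 0 := by
  ext b c
  simp [sliceMat, Matrix.of_apply]

omit [Fintype ι] [Fintype ι'] [Fintype κ'] [Fintype μ'] in
/-- Entries of the sandwich `B · M · Cᵀ`. [folklore] -/
theorem sandwich_apply (B : κ' → κ → K) (C : μ' → μ → K) (M : Matrix κ μ K) (b' : κ') (c' : μ') :
    (Matrix.of B * M * (Matrix.of C)ᵀ) b' c' = ∑ b, ∑ c, B b' b * C c' c * M b c := by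
  simp only [Matrix.mul_apply, Matrix.transpose_apply, Matrix.of_apply, Finset.sum_mul]
  rw [Finset.sum_comm]
  exact Finset.sum_congr rfl fun b _ => Finset.sum_congr rfl fun c _ => by ring

omit [Fintype ι'] [Fintype κ'] [Fintype μ'] in
/-- A restriction `s = (A ⊗ B ⊗ C) t` slice by slice: `s(a',·,·) = ∑ₐ A(a',a) · B t(a,·,·) Cᵀ`.
[folklore] -/
theorem of_slice_eq_sum {t : ι → κ → μ → K} {s : ι' → κ' → μ' → K}
    {A : ι' → ι → K} {B : κ' → κ → K} {C : μ' → μ → K}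
    (hs : ∀ a' b' c', s a' b' c' = ∑ a, ∑ b, ∑ c, A a' a * B b' b * C c' c * t a b c) (a' : ι') :
    Matrix.of (s a') = ∑ a, A a' a • (Matrix.of B * Matrix.of (t a) * (Matrix.of C)ᵀ) := by
  ext b' c'
  rw [Matrix.sum_apply]
  simp only [Matrix.of_apply, Matrix.smul_apply, smul_eq_mul, sandwich_apply, hs]
  refine Finset.sum_congr rfl fun a _ => ?_
  rw [Finset.mul_sum]
  refine Finset.sum_congr rfl fun b _ => ?_
  rw [Finset.mul_sum]
  exact Finset.sum_congr rfl fun c _ => by ring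

omit [Fintype κ'] [Fintype μ'] in
/-- **Slice transport under restriction.**  If `s = (A ⊗ B ⊗ C) t` then the first-mode slices
satisfy `S(ξ) = B · T(ξᵀA) · Cᵀ`. [folklore] -/
theorem sliceMat_restricts {t : ι → κ → μ → K} {s : ι' → κ' → μ' → K}
    {A : ι' → ι → K} {B : κ' → κ → K} {C : μ' → μ → K}
    (hs : ∀ a' b' c', s a' b' c' = ∑ a, ∑ b, ∑ c, A a' a * B b' b * C c' c * t a b c) (ξ : ι' → K) :
    sliceMat s ξ = Matrix.of B * sliceMat t (ξ ᵥ* Matrix.of A) * (Matrix.of C)ᵀ := by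
  rw [sliceMat_eq_sum, sliceMat_eq_sum]
  simp_rw [of_slice_eq_sum hs, Finset.smul_sum, smul_smul]
  rw [Finset.sum_comm]
  simp_rw [← Finset.sum_smul]
  rw [Matrix.mul_sum, Matrix.sum_mul]
  refine Finset.sum_congr rfl fun a _ => ?_
  rw [Matrix.mul_smul, Matrix.smul_mul]
  congr 1

omit [Fintype ι'] [Fintype κ'] [Fintype μ'] in
/-- Rotating the modes of a restriction, with the SAME matrices. [folklore] -/
theorem restricts_rotate {t : ι → κ → μ → K} {s : ι' → κ' → μ' → K}
    {A : ι' → ι → K} {B : κ' → κ → K} {C : μ' → μ → K}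
    (hs : ∀ a' b' c', s a' b' c' = ∑ a, ∑ b, ∑ c, A a' a * B b' b * C c' c * t a b c) :
    ∀ b' c' a', rotate s b' c' a' = ∑ b, ∑ c, ∑ a, B b' b * C c' c * A a' a * rotate t b c a := by
  intro b' c' a'
  rw [rotate_apply, hs a' b' c', Finset.sum_comm]
  refine Finset.sum_congr rfl fun b _ => ?_
  rw [Finset.sum_comm]
  refine Finset.sum_congr rfl fun c _ => Finset.sum_congr rfl fun a _ => ?_
  rw [rotate_apply]; ring

omit [Fintype κ'] [Fintype μ'] in
/-- **Conciseness ⇒ injectivity.**  If `s = (A ⊗ B ⊗ C) t` and the first-mode slices of `s` are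
linearly independent, then `ξ ↦ ξᵀA` is injective. [folklore] -/
theorem toLin'_injective_of_restricts [DecidableEq ι] [DecidableEq ι']
    {t : ι → κ → μ → K} {s : ι' → κ' → μ' → K}
    {A : ι' → ι → K} {B : κ' → κ → K} {C : μ' → μ → K}
    (hs : ∀ a' b' c', s a' b' c' = ∑ a, ∑ b, ∑ c, A a' a * B b' b * C c' c * t a b c)
    (hli : LinearIndependent K (fun a' => s a' : ι' → κ' → μ' → K)) :
    Function.Injective (Matrix.toLin' (Matrix.of A)ᵀ) := by
  rw [injective_iff_map_eq_zero]
  intro ξ hξ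
  have hη : ξ ᵥ* Matrix.of A = 0 := by
    rw [← Matrix.mulVec_transpose]; simpa [Matrix.toLin'_apply] using hξ
  have hS : sliceMat s ξ = 0 := by
    rw [sliceMat_restricts hs ξ, hη, sliceMat_zero]; simp
  funext a'
  refine Fintype.linearIndependent_iff.1 hli ξ ?_ a'
  funext b c
  have h := congr_fun (congr_fun hS b) c
  simpa [sliceMat, Matrix.of_apply, Finset.sum_apply, Pi.smul_apply, smul_eq_mul] using h

/-- An injective `Y × X` matrix between index types of equal size has a left inverse.
[folklore] -/
theorem exists_left_inverse {X Y : Type*} [Fintype X] [Fintype Y] [DecidableEq X] [DecidableEq Y]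
    (M : Matrix Y X K) (hinj : Function.Injective (Matrix.toLin' Mᵀ))
    (hcard : Fintype.card Y = Fintype.card X) :
    ∃ L : Matrix X Y K, L * M = 1 := by
  have hfin : Module.finrank K (Y → K) = Module.finrank K (X → K) := by
    simp [Module.finrank_fintype_fun_eq_card, hcard]
  have hbij : Function.Bijective (Matrix.toLin' Mᵀ) :=
    ⟨hinj, (LinearMap.injective_iff_surjective_of_finrank_eq_finrank hfin).1 hinj⟩
  let e : (Y → K) ≃ₗ[K] (X → K) := LinearEquiv.ofBijective (Matrix.toLin' Mᵀ) hbij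
  have he : ∀ x, e x = Matrix.toLin' Mᵀ x := fun _ => rfl
  refine ⟨(LinearMap.toMatrix' (e.symm : (X → K) →ₗ[K] (Y → K)))ᵀ, ?_⟩
  have h1 : Mᵀ * LinearMap.toMatrix' (e.symm : (X → K) →ₗ[K] (Y → K)) = 1 := by
    apply Matrix.toLin'.injective
    rw [Matrix.toLin'_mul, Matrix.toLin'_toMatrix', Matrix.toLin'_one]
    apply LinearMap.ext
    intro v
    simp only [LinearMap.comp_apply, LinearEquiv.coe_coe, LinearMap.id_apply]
    rw [← he, LinearEquiv.apply_symm_apply]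
  have h2 := congrArg Matrix.transpose h1
  simpa [Matrix.transpose_mul] using h2

/-- Rank is invariant under a sandwich by matrices with one-sided inverses. [folklore] -/
theorem rank_sandwich {X Y : Type*} [Fintype X] [Fintype Y] [DecidableEq X] [DecidableEq Y]
    (B C : Matrix Y X K) (LB LC : Matrix X Y K) (hLB : LB * B = 1) (hLC : LC * C = 1)
    (D : Matrix X X K) : (B * D * Cᵀ).rank = D.rank := by
  apply le_antisymm
  · exact (Matrix.rank_mul_le_left _ _).trans (Matrix.rank_mul_le_right _ _)
  · have hD : D = LB * (B * D * Cᵀ) * LCᵀ := by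
      calc D = (LB * B) * D * (LC * C)ᵀ := by rw [hLB, hLC]; simp
        _ = LB * (B * D * Cᵀ) * LCᵀ := by
          simp only [Matrix.transpose_mul, Matrix.mul_assoc]
    calc D.rank = (LB * (B * D * Cᵀ) * LCᵀ).rank := by rw [← hD]
      _ ≤ (B * D * Cᵀ).rank := (Matrix.rank_mul_le_left _ _).trans (Matrix.rank_mul_le_right _ _)

end General

/-! ## The two explicit slice ranks -/

section SliceRanks

/-- The first-mode slice of `cw_q^{⊠N}` at the word `0^N` is the diagonal 0/1 matrix supported on
the words avoiding the letter `0`. [new] -/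
theorem sliceMat_cwPow_zero (q N : ℕ) :
    sliceMat (kroneckerPow (cwTensor ℂ q) N) (fun a => if a = 0 then 1 else 0) =
      Matrix.diagonal (fun b : Fin N → Fin (q + 1) => if (∀ p, b p ≠ 0) then (1 : ℂ) else 0) := by
  ext b c
  simp only [sliceMat, Matrix.of_apply, ite_mul, one_mul, zero_mul, Finset.sum_ite_eq',
    Finset.mem_univ, if_true, kroneckerPow_apply, Pi.zero_apply, cwTensor_apply,
    Matrix.diagonal_apply]
  by_cases hbc : b = c
  · subst hbc
    rw [if_pos rfl]
    by_cases hall : ∀ p, b p ≠ 0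
    · rw [if_pos hall]
      exact Finset.prod_eq_one fun p _ => by simp [hall p]
    · rw [if_neg hall]
      obtain ⟨p, hp⟩ := not_forall.mp hall
      apply Finset.prod_eq_zero (Finset.mem_univ p)
      simp only [ne_eq, not_not] at hp
      simp [hp]
  · rw [if_neg hbc]
    obtain ⟨p, hp⟩ := Function.ne_iff.1 hbc
    apply Finset.prod_eq_zero (Finset.mem_univ p)
    simp [hp]

/-- `rank cw_q^{⊠N}(0^N,·,·) = q^N`. [new] -/
theorem rank_sliceMat_cwPow_zero (q N : ℕ) :
    (sliceMat (kroneckerPow (cwTensor ℂ q) N) (fun a => if a = 0 then 1 else 0)).rank = q ^ N := by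
  classical
  rw [sliceMat_cwPow_zero, Matrix.rank_diagonal]
  have e1 : {b : Fin N → Fin (q + 1) //
      (fun b : Fin N → Fin (q + 1) => if (∀ p, b p ≠ 0) then (1 : ℂ) else 0) b ≠ 0}
      ≃ {b : Fin N → Fin (q + 1) // ∀ p, b p ≠ 0} :=
    Equiv.subtypeEquivRight fun b => by simp
  have e2 : {b : Fin N → Fin (q + 1) // ∀ p, b p ≠ 0} ≃ (Fin N → {x : Fin (q + 1) // x ≠ 0}) :=
    Equiv.subtypePiEquivPi (β := fun _ : Fin N => Fin (q + 1)) (p := fun _ x => x ≠ 0)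
  rw [Fintype.card_congr (e1.trans e2), Fintype.card_fun, Fintype.card_fin]
  have hq : Fintype.card {x : Fin (q + 1) // x ≠ 0} = q := by
    rw [Fintype.card_subtype_compl, Fintype.card_fin, Fintype.card_unique]
    omega
  rw [hq]

/-- The first-mode slice of `⟨m,m,m⟩` at `ξ` is, up to reindexing the columns, the block-diagonal
matrix with `m` copies of `ξ` (read as an `m × m` matrix). [folklore] -/
theorem sliceMat_matMul_eq (m : ℕ) (ξ : Fin m × Fin m → ℂ) :
    sliceMat (matMulTensor ℂ m m m) ξ =
      Matrix.reindex (Equiv.refl _) (Equiv.prodComm (Fin m) (Fin m))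
        (Matrix.blockDiagonal fun _ : Fin m => (Matrix.of fun κ ν : Fin m => ξ (κ, ν))) := by
  ext ⟨κ, μ⟩ ⟨μ', ν⟩
  simp only [sliceMat, Matrix.of_apply, matMulTensor, Matrix.reindex_apply, Matrix.submatrix_apply,
    Equiv.refl_symm, Equiv.coe_refl, id_eq, Equiv.prodComm_symm, Equiv.prodComm_apply,
    Prod.swap_prod_mk, Matrix.blockDiagonal_apply, Matrix.of_apply, mul_ite, mul_one, mul_zero]
  by_cases hμ : μ = μ'
  · subst hμ
    simp only [true_and, if_true]
    rw [Finset.sum_eq_single (κ, ν)]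
    · simp
    · rintro ⟨κ', ν'⟩ - hne
      rw [if_neg]
      rintro ⟨h1, h2⟩
      exact hne (Prod.ext h1 h2)
    · simp
  · rw [if_neg hμ]
    exact Finset.sum_eq_zero fun a _ => by simp [hμ]

/-- `rank ⟨m,m,m⟩(ξ,·,·) = m · rank ξ`. [folklore] -/
theorem rank_sliceMat_matMul (m : ℕ) (ξ : Fin m × Fin m → ℂ) :
    (sliceMat (matMulTensor ℂ m m m) ξ).rank = m * (Matrix.of fun κ ν : Fin m => ξ (κ, ν)).rank := by
  rw [sliceMat_matMul_eq, Matrix.rank_reindex,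
    Literature.Barriers.ValiantsHypothesis.rank_blockDiagonal]
  simp

end SliceRanks

/-! ## The theorem, for every little Coppersmith–Winograd tensor `cw_q` -/

/-- Conciseness gives injective covector maps for all three restriction matrices. [folklore] -/
theorem injective_three {q N m : ℕ} [NeZero m]
    {A : Fin m × Fin m → (Fin N → Fin (q + 1)) → ℂ} {B : Fin m × Fin m → (Fin N → Fin (q + 1)) → ℂ}
    {C : Fin m × Fin m → (Fin N → Fin (q + 1)) → ℂ}
    (hs : ∀ a' b' c', matMulTensor ℂ m m m a' b' c' =
      ∑ a, ∑ b, ∑ c, A a' a * B b' b * C c' c * kroneckerPow (cwTensor ℂ q) N a b c) :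
    Function.Injective (Matrix.toLin' (Matrix.of A)ᵀ) ∧
      Function.Injective (Matrix.toLin' (Matrix.of B)ᵀ) ∧
      Function.Injective (Matrix.toLin' (Matrix.of C)ᵀ) := by
  refine ⟨toLin'_injective_of_restricts hs (linearIndependent_matMulTensor ℂ m m m),
    toLin'_injective_of_restricts (restricts_rotate hs) (linearIndependent_rotate_matMulTensor ℂ m m m),
    toLin'_injective_of_restricts (restricts_rotate (restricts_rotate hs))
      (linearIndependent_rotate_rotate_matMulTensor ℂ m m m)⟩

/-- **Flattening, re-derived**: `⟨m,m,m⟩ ≤ cw_q^{⊠N} ⟹ m² ≤ (q+1)^N`. [folklore] -/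
theorem sq_le_pow_of_restricts {q N m : ℕ}
    (h : TensorRestrictsTo (kroneckerPow (cwTensor ℂ q) N) (matMulTensor ℂ m m m)) :
    m ^ 2 ≤ (q + 1) ^ N := by
  rcases Nat.eq_zero_or_pos m with rfl | hm
  · simp
  haveI : NeZero m := ⟨hm.ne'⟩
  obtain ⟨A, B, C, hs⟩ := h
  have hA := (injective_three hs).1
  have := LinearMap.finrank_le_finrank_of_injective hA
  simpa [Module.finrank_fintype_fun_eq_card, Fintype.card_prod, Fintype.card_fun, sq] using this

/-- **No exact perfection, for every `cw_q`**: `⟨m,m,m⟩ ≤ cw_q^{⊠N}` with `q, N ≥ 1` forces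
`m² ≠ (q+1)^N`.  (A prime `p ∣ m` would divide both `(q+1)^N = m²` and `q^N = m · rank ξ₀`.)
[new] -/
theorem sq_ne_pow_of_restricts {q N m : ℕ} (hq : 1 ≤ q) (hN : 1 ≤ N)
    (h : TensorRestrictsTo (kroneckerPow (cwTensor ℂ q) N) (matMulTensor ℂ m m m)) :
    m ^ 2 ≠ (q + 1) ^ N := by
  classical
  intro hsq
  have hm2 : 2 ≤ m := by
    by_contra hlt
    have hm1 : m ^ 2 ≤ 1 := by nlinarith
    have h1N : (q + 1) ^ 1 ≤ (q + 1) ^ N := Nat.pow_le_pow_right (by omega) hN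
    rw [pow_one] at h1N
    omega
  haveI : NeZero m := ⟨by omega⟩
  obtain ⟨A, B, C, hs⟩ := h
  obtain ⟨hA, hB, hC⟩ := injective_three hs
  have hcard : Fintype.card (Fin m × Fin m) = Fintype.card (Fin N → Fin (q + 1)) := by
    simp [Fintype.card_prod, ← hsq, sq]
  have hfin : Module.finrank ℂ (Fin m × Fin m → ℂ) =
      Module.finrank ℂ ((Fin N → Fin (q + 1)) → ℂ) := by
    simp [Module.finrank_fintype_fun_eq_card, hcard]
  -- a covector `ξ₀` transported onto the indicator of the word `0^N`
  set e₀ : (Fin N → Fin (q + 1)) → ℂ := fun a => if a = 0 then 1 else 0 with he₀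
  obtain ⟨ξ₀, hξ₀⟩ := (LinearMap.injective_iff_surjective_of_finrank_eq_finrank hfin).1 hA e₀
  have hξ₀' : ξ₀ ᵥ* Matrix.of A = e₀ := by
    rw [← Matrix.mulVec_transpose]; simpa [Matrix.toLin'_apply] using hξ₀
  -- left inverses of `B` and `C`
  obtain ⟨LB, hLB⟩ := exists_left_inverse (Matrix.of B) hB hcard
  obtain ⟨LC, hLC⟩ := exists_left_inverse (Matrix.of C) hC hcard
  -- the slice of `⟨m,m,m⟩` at `ξ₀` is the sandwich of the diagonal slice of `cw_q^{⊠N}` at `0^N`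
  have hS : sliceMat (matMulTensor ℂ m m m) ξ₀ =
      Matrix.of B * sliceMat (kroneckerPow (cwTensor ℂ q) N) e₀ * (Matrix.of C)ᵀ := by
    rw [sliceMat_restricts hs ξ₀, hξ₀']
  have hrank := congrArg Matrix.rank hS
  rw [rank_sandwich _ _ LB LC hLB hLC, he₀, rank_sliceMat_cwPow_zero, rank_sliceMat_matMul] at hrank
  -- a prime factor of `m` divides `(q+1)^N = m²` and `q^N = m · r`: absurd
  obtain ⟨p, hp, hpm⟩ := Nat.exists_prime_and_dvd (show m ≠ 1 by omega)
  have hp1 : p ∣ q + 1 := by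
    refine hp.dvd_of_dvd_pow (n := N) ?_
    rw [← hsq]
    exact dvd_pow hpm two_ne_zero
  have hp2 : p ∣ q := by
    refine hp.dvd_of_dvd_pow (n := N) ?_
    rw [← hrank]
    exact Dvd.dvd.mul_right hpm _
  have : p ∣ 1 := by
    have := Nat.dvd_sub hp1 hp2
    simpa using this
  exact hp.one_lt.ne' (Nat.dvd_one.mp this)

/-- The case `q = 2`: `⟨m,m,m⟩ ≤ cw₂^{⊠N}`, `N ≥ 1` ⟹ `m² ≠ 3^N`. [new] -/
theorem sq_ne_three_pow {N m : ℕ} (hN : 1 ≤ N)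
    (h : TensorRestrictsTo (kroneckerPow (cwTensor ℂ 2) N) (matMulTensor ℂ m m m)) :
    m ^ 2 ≠ 3 ^ N :=
  sq_ne_pow_of_restricts (q := 2) (by norm_num) hN h

/-- **Aside `CwTwoNoExactPerfection` of route OutsiderSandwich, proved by name** (item
stmt-MatrixMultiplication-29786): `⟨m,m,m⟩ ≤ cw₂^{⊠N}`, `N ≥ 1` ⟹ `m² < 3^N`. [new] -/
theorem cwTwoNoExactPerfection_holds :
    Summit.MatrixMultiplication.MatrixMultiplication.Theses.OutsiderSandwich.CwTwoNoExactPerfection :=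
  fun _N _m hN h => lt_of_le_of_ne (sq_le_pow_of_restricts (q := 2) h) (sq_ne_three_pow hN h)

/-- **Aside `MMThreeNotInCwTwoPowTwo` of route OutsiderSandwich, proved by name** (item
stmt-MatrixMultiplication-29787): `⟨3,3,3⟩ ⋬ cw₂^{⊠2}` — the case `N = 2`, `m = 3`
(`9 < 9` is absurd); no border-rank input. [new] -/
theorem mmThreeNotInCwTwoPowTwo_holds :
    Summit.MatrixMultiplication.MatrixMultiplication.Theses.OutsiderSandwich.MMThreeNotInCwTwoPowTwo :=
  fun h => absurd (cwTwoNoExactPerfection_holds 2 3 (by norm_num) h) (by norm_num)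

end Summit.MatrixMultiplication.MatrixMultiplication.Theorems.OutsiderSandwichNoExactPerfection
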